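import Summits.Ventures.LatticeQCDFlow.Scoring.NonabelianAreaLaw2DNestedLoops
import Summits.Ventures.LatticeQCDFlow.Scoring.SUNWilsonLoopSecondMoment2D
import HarnessLib

/-!
# The exact correlation of two NESTED two-dimensional `SU(N)` Wilson loops: `⟨tr W_{R×T} · conj tr W_{R'×T}⟩_β = P_N(β)^{(R−R')T}·(1 + (N²−1)·P_adj(β)^{R'T})` (`D = Σ_q det[I_{|q+i−j|}(β)]`)

HONEST FRAMING: exact (Metropolis-corrected) sampling algorithms for lattice gauge theory;
figures of merit are autocorrelation/cost numbers at stated couplings and volumes; no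
continuum-physics claim.

Venture `LatticeQCDFlow` (cell pub-lqcd), sub-topic `Scoring`; FANOUT row 5 (`s0-sun-a`), GEN-21.
NEW WORK of the cell (placement rule).  The `SU(N)` twin of `UNNestedWilsonLoopCovariance2D`: for the free-boundary
`R × T` lattice of two-dimensional `SU(N)` lattice Yang–Mills (`N ≥ 2`, every real `β`, weight `e^{−β(N − Re tr U_p)}`,
realised in `(ℤ/L)²`, `R + 1 ≤ L`, `T + 1 ≤ L`) and the two loops `W = W_{R×T}`, `W' = W_{R'×T}` with common corner
and height, `R = R' + k`:

  **`⟨tr W · conj(tr W')⟩_β = P_N(β)^{kT} · (1 + (N² − 1)·P_adj(β)^{R'T})`**,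

`P_N = ∫N⁻¹Re tr u·e^{−β(N−Re tr u)}du / ∫e^{−β(N−Re tr u)}du` over `SU(N)` (GEN-18's one-plaquette plaquette),
`P_adj = (M₂/D − 1)/(N² − 1)`, `M₂ = ∫_{SU(N)}|tr u|²e^{βRe tr u}du`, `D = Σ_q det[I_{|q+i−j|}(β)] = ∫_{SU(N)}e^{βRe tr u}du`
(GEN-21).  With the means `⟨tr W⟩ = N·P_N^{RT}`, `⟨tr W'⟩ = N·P_N^{R'T}` (GEN-18) this is the exact covariance
`Cov_β(tr W, tr W') = P_N^{kT}(1 + (N²−1)P_adj^{R'T}) − N²·P_N^{(R+R')T}` of two nested `SU(N)` loops — the input of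
the error propagation of Creutz ratios in two dimensions; `k = 0` is `SUNWilsonLoopSecondMoment2D`.
Route: GEN-21's nested area law (`NonabelianAreaLaw2DNestedLoops`, `ρ = u`, `σ = ū`), Schur for the outer factor
(`M_ρ = m·1`, `specialUnitary_integralMatrix_eq_smul_one`), and `tr M_{u⊗ū}^{R'T} = D^{R'T} + (N²−1)A^{R'T}`
(`specialUnitary_trace_kroneckerConj_integral_pow`, GEN-21).

* `specialUnitary_open_trace_mul_conj_trace_nested_integral_eq` (unnormalised),
  **`specialUnitary_open_trace_mul_conj_trace_nested_eq`**.

No `def`, nothing cited as a fact, 0 sorry.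
-/

noncomputable section

open MeasureTheory Function Finset
open Literature.MathematicalPhysics.QuantumFieldTheory
open Literature.MathematicalPhysics.QuantumLattice
open Summit.Ventures.LatticeQCDFlow.Theory2.Lattice
open Summit.Ventures.LatticeQCDFlow.Theory2.Lattice.TwoDim
open Literature.Analysis.FunctionSpaces (besselI)
open scoped Kronecker

namespace Summit.Ventures.LatticeQCDFlow.Scoring

section Nested

variable {L : ℕ} [NeZero L] {N : ℕ}

/-- **THE UNNORMALISED NESTED CORRELATION** (`SU(N)`, `N ≥ 2`, `R = R' + k`, `R + 1 ≤ L`, `T + 1 ≤ L`):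
`∫ tr W_{R×T} · conj(tr W_{R'×T}) ∏_{p∈B_{R×T}} e^{−β(N−Re tr U_p)} = m^{kT} · e^{−NβR'T}·(D^{R'T} + (N²−1)A^{R'T})`,
`m = N⁻¹∫_{SU(N)}Re tr u·e^{−β(N−Re tr u)}du` the scalar of the one-plaquette matrix, `D = Σ_q det[I_{|q+i−j|}(β)]`. -/
theorem specialUnitary_open_trace_mul_conj_trace_nested_integral_eq (hN : 2 ≤ N) (β : ℝ) (i j : ZMod L) {R' k T : ℕ}
    (hR : R' + k + 1 ≤ L) (hT : T + 1 ≤ L) :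
    ∫ U, ((rectangleHolonomy U ![i, j] 0 1 (R' + k) T : Matrix.specialUnitaryGroup (Fin N) ℂ) : Matrix (Fin N) (Fin N) ℂ).trace *
        (starRingEnd ℂ) ((rectangleHolonomy U ![i, j] 0 1 R' T : Matrix.specialUnitaryGroup (Fin N) ℂ) :
          Matrix (Fin N) (Fin N) ℂ).trace *
        ∏ p ∈ (range (R' + k) ×ˢ range T).image (fun q : ℕ × ℕ => (![i + q.1, j + q.2] : Site 2 L)),
          (Real.exp (-(β * ((N : ℝ) - ((plaquetteHolonomy U p 0 1 : Matrix.specialUnitaryGroup (Fin N) ℂ) :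
            Matrix (Fin N) (Fin N) ℂ).trace.re))) : ℂ)
        ∂(Measure.pi fun _ : Edge 2 L => haarProbability (Matrix.specialUnitaryGroup (Fin N) ℂ)) =
      (((N : ℝ)⁻¹ * ∫ u, ((u : Matrix.specialUnitaryGroup (Fin N) ℂ) : Matrix (Fin N) (Fin N) ℂ).trace.re *
          Real.exp (-(β * ((N : ℝ) - ((u : Matrix.specialUnitaryGroup (Fin N) ℂ) : Matrix (Fin N) (Fin N) ℂ).trace.re)))
          ∂(haarProbability (Matrix.specialUnitaryGroup (Fin N) ℂ)) : ℝ) : ℂ) ^ (k * T) *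
        ((Real.exp (-(N * β)) : ℂ) ^ (R' * T) *
          ((((∑' q : ℤ, (Matrix.of fun i j : Fin N => besselI (q + (i : ℤ) - (j : ℤ)).natAbs β).det) : ℝ) : ℂ) ^ (R' * T) +
            ((N : ℂ) ^ 2 - 1) *
              ((((∫ u, (‖((u : Matrix.specialUnitaryGroup (Fin N) ℂ) : Matrix (Fin N) (Fin N) ℂ).trace‖ ^ 2 : ℝ) *
                  Real.exp (β * ((u : Matrix.specialUnitaryGroup (Fin N) ℂ) : Matrix (Fin N) (Fin N) ℂ).trace.re)
                  ∂(haarProbability (Matrix.specialUnitaryGroup (Fin N) ℂ))) -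
                  (∑' q : ℤ, (Matrix.of fun i j : Fin N => besselI (q + (i : ℤ) - (j : ℤ)).natAbs β).det)) / ((N : ℝ) ^ 2 - 1) : ℝ) : ℂ) ^
                (R' * T))) := by
  haveI : NeZero N := ⟨by omega⟩
  set ρ := fundamentalRep (Fin N) with hρ
  set σ : Matrix.specialUnitaryGroup (Fin N) ℂ →* Matrix (Fin N) (Fin N) ℂ :=
    ((starRingEnd ℂ).mapMatrix : Matrix (Fin N) (Fin N) ℂ →+* Matrix (Fin N) (Fin N) ℂ).toMonoidHom.comp
      (fundamentalRep (Fin N)) with hσ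
  have hσa : ∀ g : Matrix.specialUnitaryGroup (Fin N) ℂ, σ g = ((g : Matrix.specialUnitaryGroup (Fin N) ℂ) : Matrix (Fin N) (Fin N) ℂ).map (starRingEnd ℂ) :=
    fun g => rfl
  have hw : Continuous fun u : Matrix.specialUnitaryGroup (Fin N) ℂ =>
      Real.exp (-(β * ((N : ℝ) - ((u : Matrix.specialUnitaryGroup (Fin N) ℂ) : Matrix (Fin N) (Fin N) ℂ).trace.re))) := by
    fun_prop
  have hF : Continuous fun x : ℝ => Real.exp (-(β * ((N : ℝ) - x))) := by fun_prop
  -- the nested area law, entrywise, summed over the two diagonals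
  have hnest := integral_rep_rectangleHolonomy_mul_rep_inner_mul_prod_weight (L := L) ρ σ
    (continuous_fundamentalRep (Fin N)) (continuous_conj_fundamentalRep N) hw
    (specialUnitary_wilsonWeight_conj N β) i j hT R'
  -- the outer one-plaquette matrix is scalar
  set m : ℝ := (N : ℝ)⁻¹ * ∫ u, ((u : Matrix.specialUnitaryGroup (Fin N) ℂ) : Matrix (Fin N) (Fin N) ℂ).trace.re *
      Real.exp (-(β * ((N : ℝ) - ((u : Matrix.specialUnitaryGroup (Fin N) ℂ) : Matrix (Fin N) (Fin N) ℂ).trace.re)))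
      ∂(haarProbability (Matrix.specialUnitaryGroup (Fin N) ℂ)) with hm
  have hM : (Matrix.of fun k l : Fin N => ∫ g, ρ g k l *
      (Real.exp (-(β * ((N : ℝ) - ((g : Matrix.specialUnitaryGroup (Fin N) ℂ) : Matrix (Fin N) (Fin N) ℂ).trace.re))) : ℂ)
        ∂(haarProbability (Matrix.specialUnitaryGroup (Fin N) ℂ))) = (m : ℂ) • (1 : Matrix (Fin N) (Fin N) ℂ) := by
    simp only [hρ, fundamentalRep_apply]
    exact specialUnitary_integralMatrix_eq_smul_one N hF
  -- the inner Kronecker matrix splits off `e^{−Nβ}`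
  have hsplit : ∀ u : Matrix.specialUnitaryGroup (Fin N) ℂ,
      (Real.exp (-(β * ((N : ℝ) - ((u : Matrix.specialUnitaryGroup (Fin N) ℂ) : Matrix (Fin N) (Fin N) ℂ).trace.re))) : ℂ) =
        (Real.exp (-(N * β)) : ℂ) *
          (Real.exp (β * ((u : Matrix.specialUnitaryGroup (Fin N) ℂ) : Matrix (Fin N) (Fin N) ℂ).trace.re) : ℂ) := by
    intro u; rw [← Complex.ofReal_mul, ← Real.exp_add]; congr 2; ring
  have hX : (Matrix.of fun k l : Fin N × Fin N => ∫ g, (ρ g ⊗ₖ σ g) k l *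
        (Real.exp (-(β * ((N : ℝ) - ((g : Matrix.specialUnitaryGroup (Fin N) ℂ) : Matrix (Fin N) (Fin N) ℂ).trace.re))) : ℂ)
        ∂(haarProbability (Matrix.specialUnitaryGroup (Fin N) ℂ))) =
      (Real.exp (-(N * β)) : ℂ) • (Matrix.of fun k l : Fin N × Fin N => ∫ u,
        (((u : Matrix.specialUnitaryGroup (Fin N) ℂ) : Matrix (Fin N) (Fin N) ℂ) ⊗ₖ
          (((u : Matrix.specialUnitaryGroup (Fin N) ℂ) : Matrix (Fin N) (Fin N) ℂ).map (starRingEnd ℂ))) k l *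
        (Real.exp (β * ((u : Matrix.specialUnitaryGroup (Fin N) ℂ) : Matrix (Fin N) (Fin N) ℂ).trace.re) : ℂ)
        ∂(haarProbability (Matrix.specialUnitaryGroup (Fin N) ℂ))) := by
    ext k l
    simp only [Matrix.of_apply, Matrix.smul_apply, smul_eq_mul, hσa, hρ, fundamentalRep_apply, hsplit]
    rw [← integral_const_mul]
    exact integral_congr_ae (ae_of_all _ fun u => by ring)
  -- continuity / integrability of the integrand pieces
  have hW : ∀ R₀ : ℕ, Continuous fun U : GaugeConfig 2 L (Matrix.specialUnitaryGroup (Fin N) ℂ) =>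
      ((rectangleHolonomy U ![i, j] 0 1 R₀ T : Matrix.specialUnitaryGroup (Fin N) ℂ) : Matrix (Fin N) (Fin N) ℂ).trace :=
    fun R₀ => (continuous_fundamentalRep (Fin N)).matrix_trace.comp (continuous_config_rectangleHolonomy _ 0 1 R₀ T)
  have hΨc : Continuous fun U : GaugeConfig 2 L (Matrix.specialUnitaryGroup (Fin N) ℂ) =>
      ∏ p ∈ (range (R' + k) ×ˢ range T).image (fun q : ℕ × ℕ => (![i + q.1, j + q.2] : Site 2 L)),
        (Real.exp (-(β * ((N : ℝ) - ((plaquetteHolonomy U p 0 1 : Matrix.specialUnitaryGroup (Fin N) ℂ) :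
          Matrix (Fin N) (Fin N) ℂ).trace.re))) : ℂ) :=
    continuous_finsetProd _ fun p _ => Complex.continuous_ofReal.comp (hw.comp (continuous_config_plaquetteHolonomy p 0 1))
  have hint : ∀ a c : Fin N, Integrable (fun U : GaugeConfig 2 L (Matrix.specialUnitaryGroup (Fin N) ℂ) =>
      ρ (rectangleHolonomy U ![i, j] 0 1 (R' + k) T) a a * σ (rectangleHolonomy U ![i, j] 0 1 R' T) c c *
        ∏ p ∈ (range (R' + k) ×ˢ range T).image (fun q : ℕ × ℕ => (![i + q.1, j + q.2] : Site 2 L)),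
          (Real.exp (-(β * ((N : ℝ) - ((plaquetteHolonomy U p 0 1 : Matrix.specialUnitaryGroup (Fin N) ℂ) :
            Matrix (Fin N) (Fin N) ℂ).trace.re))) : ℂ))
      (Measure.pi fun _ : Edge 2 L => haarProbability (Matrix.specialUnitaryGroup (Fin N) ℂ)) := fun a c =>
    integrable_gaugeConfig_of_continuous (((((continuous_fundamentalRep (Fin N)).comp
      (continuous_config_rectangleHolonomy _ 0 1 (R' + k) T)).matrix_elem a a).mul
      (((continuous_conj_fundamentalRep N).comp (continuous_config_rectangleHolonomy _ 0 1 R' T)).matrix_elem c c)).mul hΨc)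
  -- expand tr · conj tr into diagonal entries
  have hpt : ∀ U : GaugeConfig 2 L (Matrix.specialUnitaryGroup (Fin N) ℂ),
      ((rectangleHolonomy U ![i, j] 0 1 (R' + k) T : Matrix.specialUnitaryGroup (Fin N) ℂ) : Matrix (Fin N) (Fin N) ℂ).trace *
        (starRingEnd ℂ) ((rectangleHolonomy U ![i, j] 0 1 R' T : Matrix.specialUnitaryGroup (Fin N) ℂ) :
          Matrix (Fin N) (Fin N) ℂ).trace *
        ∏ p ∈ (range (R' + k) ×ˢ range T).image (fun q : ℕ × ℕ => (![i + q.1, j + q.2] : Site 2 L)),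
          (Real.exp (-(β * ((N : ℝ) - ((plaquetteHolonomy U p 0 1 : Matrix.specialUnitaryGroup (Fin N) ℂ) :
            Matrix (Fin N) (Fin N) ℂ).trace.re))) : ℂ) =
      ∑ a, ∑ c, ρ (rectangleHolonomy U ![i, j] 0 1 (R' + k) T) a a * σ (rectangleHolonomy U ![i, j] 0 1 R' T) c c *
        ∏ p ∈ (range (R' + k) ×ˢ range T).image (fun q : ℕ × ℕ => (![i + q.1, j + q.2] : Site 2 L)),
          (Real.exp (-(β * ((N : ℝ) - ((plaquetteHolonomy U p 0 1 : Matrix.specialUnitaryGroup (Fin N) ℂ) :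
            Matrix (Fin N) (Fin N) ℂ).trace.re))) : ℂ) := by
    intro U
    rw [← trace_map_starRingEnd, Matrix.trace, Matrix.trace, Finset.sum_mul, Finset.sum_mul]
    refine Finset.sum_congr rfl fun a _ => ?_
    rw [Matrix.diag_apply, Finset.mul_sum, Finset.sum_mul]
    rfl
  rw [integral_congr_ae (ae_of_all _ hpt), integral_finsetSum _ fun a _ => integrable_finsetSum _ fun c _ => hint a c]
  simp_rw [integral_finsetSum _ fun c _ => hint _ c]
  set X : Matrix (Fin N × Fin N) (Fin N × Fin N) ℂ := Matrix.of fun k l : Fin N × Fin N => ∫ u,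
        (((u : Matrix.specialUnitaryGroup (Fin N) ℂ) : Matrix (Fin N) (Fin N) ℂ) ⊗ₖ
          (((u : Matrix.specialUnitaryGroup (Fin N) ℂ) : Matrix (Fin N) (Fin N) ℂ).map (starRingEnd ℂ))) k l *
        (Real.exp (β * ((u : Matrix.specialUnitaryGroup (Fin N) ℂ) : Matrix (Fin N) (Fin N) ℂ).trace.re) : ℂ)
        ∂(haarProbability (Matrix.specialUnitaryGroup (Fin N) ℂ)) with hXdef
  have hterm : ∀ a c : Fin N,
      ∫ U, ρ (rectangleHolonomy U ![i, j] 0 1 (R' + k) T) a a * σ (rectangleHolonomy U ![i, j] 0 1 R' T) c c *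
        ∏ p ∈ (range (R' + k) ×ˢ range T).image (fun q : ℕ × ℕ => (![i + q.1, j + q.2] : Site 2 L)),
          (Real.exp (-(β * ((N : ℝ) - ((plaquetteHolonomy U p 0 1 : Matrix.specialUnitaryGroup (Fin N) ℂ) :
            Matrix (Fin N) (Fin N) ℂ).trace.re))) : ℂ)
        ∂(Measure.pi fun _ : Edge 2 L => haarProbability (Matrix.specialUnitaryGroup (Fin N) ℂ)) =
      (m : ℂ) ^ (k * T) * ((Real.exp (-(N * β)) : ℂ) ^ (R' * T) * (X ^ (R' * T)) (a, c) (a, c)) := by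
    intro a c
    rw [hnest c c k hR a a, hM, hX, smul_pow, smul_pow, one_pow]
    simp only [Matrix.smul_apply, Matrix.one_apply, smul_eq_mul, mul_ite, mul_one, mul_zero, ite_mul, zero_mul,
      Finset.sum_ite_eq, Finset.mem_univ, if_true]
  simp_rw [hterm, ← Finset.mul_sum]
  rw [← Fintype.sum_prod_type' (f := fun a c => (X ^ (R' * T)) (a, c) (a, c))]
  have htr : ∑ x : Fin N × Fin N, (X ^ (R' * T)) (x.1, x.2) (x.1, x.2) = (X ^ (R' * T)).trace := by
    rw [Matrix.trace]; rfl
  rw [htr, hXdef, specialUnitary_trace_kroneckerConj_integral_pow hN β (R' * T)]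


/-- **THE EXACT CORRELATION OF TWO NESTED `SU(N)` WILSON LOOPS** (`N ≥ 2`, every real `β`, `R = R' + k`,
`R + 1 ≤ L`, `T + 1 ≤ L`): `⟨tr W_{R×T} · conj(tr W_{R'×T})⟩_β = P_N(β)^{kT} · (1 + (N² − 1)·P_adj(β)^{R'T})`, with
`P_N = (N⁻¹∫Re tr u·e^{−β(N−Re tr u)}du)/(∫e^{−β(N−Re tr u)}du)` over `SU(N)` and `P_adj = (M₂/D − 1)/(N² − 1)`,
`D = Σ_q det[I_{|q+i−j|}(β)]`. -/
theorem specialUnitary_open_trace_mul_conj_trace_nested_eq (hN : 2 ≤ N) (β : ℝ) (i j : ZMod L) {R' k T : ℕ}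
    (hR : R' + k + 1 ≤ L) (hT : T + 1 ≤ L) :
    (∫ U, ((rectangleHolonomy U ![i, j] 0 1 (R' + k) T : Matrix.specialUnitaryGroup (Fin N) ℂ) : Matrix (Fin N) (Fin N) ℂ).trace *
        (starRingEnd ℂ) ((rectangleHolonomy U ![i, j] 0 1 R' T : Matrix.specialUnitaryGroup (Fin N) ℂ) :
          Matrix (Fin N) (Fin N) ℂ).trace *
        ∏ p ∈ (range (R' + k) ×ˢ range T).image (fun q : ℕ × ℕ => (![i + q.1, j + q.2] : Site 2 L)),
          (Real.exp (-(β * ((N : ℝ) - ((plaquetteHolonomy U p 0 1 : Matrix.specialUnitaryGroup (Fin N) ℂ) :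
            Matrix (Fin N) (Fin N) ℂ).trace.re))) : ℂ)
        ∂(Measure.pi fun _ : Edge 2 L => haarProbability (Matrix.specialUnitaryGroup (Fin N) ℂ))) /
      ((∫ U, ∏ p ∈ (range (R' + k) ×ˢ range T).image (fun q : ℕ × ℕ => (![i + q.1, j + q.2] : Site 2 L)),
          Real.exp (-(β * ((N : ℝ) - ((plaquetteHolonomy U p 0 1 : Matrix.specialUnitaryGroup (Fin N) ℂ) :
            Matrix (Fin N) (Fin N) ℂ).trace.re)))
        ∂(Measure.pi fun _ : Edge 2 L => haarProbability (Matrix.specialUnitaryGroup (Fin N) ℂ)) : ℝ) : ℂ) =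
      ((((N : ℝ)⁻¹ * ∫ u, ((u : Matrix.specialUnitaryGroup (Fin N) ℂ) : Matrix (Fin N) (Fin N) ℂ).trace.re *
          Real.exp (-(β * ((N : ℝ) - ((u : Matrix.specialUnitaryGroup (Fin N) ℂ) : Matrix (Fin N) (Fin N) ℂ).trace.re)))
          ∂(haarProbability (Matrix.specialUnitaryGroup (Fin N) ℂ))) /
          (∫ u, Real.exp (-(β * ((N : ℝ) - ((u : Matrix.specialUnitaryGroup (Fin N) ℂ) : Matrix (Fin N) (Fin N) ℂ).trace.re)))
            ∂(haarProbability (Matrix.specialUnitaryGroup (Fin N) ℂ))) : ℝ) : ℂ) ^ (k * T) *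
        (1 + ((N : ℂ) ^ 2 - 1) *
          ((((∫ u, (‖((u : Matrix.specialUnitaryGroup (Fin N) ℂ) : Matrix (Fin N) (Fin N) ℂ).trace‖ ^ 2 : ℝ) *
              Real.exp (β * ((u : Matrix.specialUnitaryGroup (Fin N) ℂ) : Matrix (Fin N) (Fin N) ℂ).trace.re)
              ∂(haarProbability (Matrix.specialUnitaryGroup (Fin N) ℂ))) /
              (∑' q : ℤ, (Matrix.of fun i j : Fin N => besselI (q + (i : ℤ) - (j : ℤ)).natAbs β).det) - 1) / ((N : ℝ) ^ 2 - 1) : ℝ) : ℂ) ^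
            (R' * T)) := by
  haveI : NeZero N := ⟨by omega⟩
  set M₂ : ℝ := ∫ u, (‖((u : Matrix.specialUnitaryGroup (Fin N) ℂ) : Matrix (Fin N) (Fin N) ℂ).trace‖ ^ 2 : ℝ) *
    Real.exp (β * ((u : Matrix.specialUnitaryGroup (Fin N) ℂ) : Matrix (Fin N) (Fin N) ℂ).trace.re)
    ∂(haarProbability (Matrix.specialUnitaryGroup (Fin N) ℂ)) with hM₂
  set D : ℝ := (∑' q : ℤ, (Matrix.of fun i j : Fin N => besselI (q + (i : ℤ) - (j : ℤ)).natAbs β).det) with hD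
  set m : ℝ := (N : ℝ)⁻¹ * ∫ u, ((u : Matrix.specialUnitaryGroup (Fin N) ℂ) : Matrix (Fin N) (Fin N) ℂ).trace.re *
      Real.exp (-(β * ((N : ℝ) - ((u : Matrix.specialUnitaryGroup (Fin N) ℂ) : Matrix (Fin N) (Fin N) ℂ).trace.re)))
      ∂(haarProbability (Matrix.specialUnitaryGroup (Fin N) ℂ)) with hm
  have hDpos : 0 < D := by
    rw [hD, ← integral_haar_specialUnitaryGroup_fin_exp_mul_trace_re N β]
    exact integral_exp_pos ((by fun_prop : Continuous fun u : Matrix.specialUnitaryGroup (Fin N) ℂ =>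
      Real.exp (β * ((u : Matrix.specialUnitaryGroup (Fin N) ℂ) : Matrix (Fin N) (Fin N) ℂ).trace.re)).integrable_of_hasCompactSupport
        (HasCompactSupport.of_compactSpace _))
  -- the one-plaquette partition function `Z₁ = e^{−Nβ} D`
  have hZ1 : ∫ u, Real.exp (-(β * ((N : ℝ) - ((u : Matrix.specialUnitaryGroup (Fin N) ℂ) : Matrix (Fin N) (Fin N) ℂ).trace.re)))
      ∂(haarProbability (Matrix.specialUnitaryGroup (Fin N) ℂ)) = Real.exp (-(N * β)) * D := by
    have hsplit : ∀ u : Matrix.specialUnitaryGroup (Fin N) ℂ,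
        Real.exp (-(β * ((N : ℝ) - ((u : Matrix.specialUnitaryGroup (Fin N) ℂ) : Matrix (Fin N) (Fin N) ℂ).trace.re))) =
          Real.exp (-(N * β)) * Real.exp (β * ((u : Matrix.specialUnitaryGroup (Fin N) ℂ) : Matrix (Fin N) (Fin N) ℂ).trace.re) := by
      intro u; rw [← Real.exp_add]; congr 1; ring
    simp_rw [hsplit]
    rw [integral_const_mul, integral_haar_specialUnitaryGroup_fin_exp_mul_trace_re]
  have hE : (0 : ℝ) < Real.exp (-(N * β)) := Real.exp_pos _
  rw [specialUnitary_open_partitionFunction_eq N β i j hR hT,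
    specialUnitary_open_trace_mul_conj_trace_nested_integral_eq (L := L) hN β i j hR hT, ← hM₂, ← hD, ← hm, hZ1]
  have hN1 : ((N : ℝ) ^ 2 - 1) ≠ 0 := by
    have h2 : (2 : ℝ) ≤ N := by exact_mod_cast hN
    nlinarith
  have hE0 : (Real.exp (-(N * β)) : ℂ) ≠ 0 := by exact_mod_cast hE.ne'
  have hD0 : (D : ℂ) ≠ 0 := by exact_mod_cast hDpos.ne'
  -- pure algebra
  have key : ∀ (mm e d c a : ℂ) (n₁ n₂ : ℕ), e ≠ 0 → d ≠ 0 →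
      mm ^ n₁ * (e ^ n₂ * (d ^ n₂ + c * a ^ n₂)) / ((e * d) ^ (n₂ + n₁)) = (mm / (e * d)) ^ n₁ * (1 + c * (a / d) ^ n₂) := by
    intro mm e d c a n₁ n₂ he hd
    rw [pow_add, mul_pow, mul_pow, div_pow, div_pow, mul_pow]
    field_simp
  have ha : (((M₂ / D - 1) / ((N : ℝ) ^ 2 - 1) : ℝ) : ℂ) = (((M₂ - D) / ((N : ℝ) ^ 2 - 1) : ℝ) : ℂ) / (D : ℂ) := by
    rw [← Complex.ofReal_div]; congr 1; field_simp
  have hq : (((m / (Real.exp (-(N * β)) * D)) : ℝ) : ℂ) = (m : ℂ) / ((Real.exp (-(N * β)) : ℂ) * (D : ℂ)) := by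
    push_cast; ring
  have hz : ((((Real.exp (-(N * β)) * D) ^ ((R' + k) * T)) : ℝ) : ℂ) =
      ((Real.exp (-(N * β)) : ℂ) * (D : ℂ)) ^ (R' * T + k * T) := by
    rw [Complex.ofReal_pow, Complex.ofReal_mul, show (R' + k) * T = R' * T + k * T by ring]
  rw [ha, hq, hz]
  exact key _ _ _ _ _ _ _ hE0 hD0

end Nested

end Summit.Ventures.LatticeQCDFlow.Scoring
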